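import Summits.QuantumFields.YangMills.Theorems.AllWindowsColdBoxDirichletPoincareSums
import Summits.QuantumFields.YangMills.Theorems.AllWindowsColdBoxDirichletCombBoundsLinear

/-!
# LINE-18 v5 of crux `BulkMidWindowSU2` (stmt-QuantumFields-24006), toward half 1 of stub S4 (`K1 → C → K2`) — part 2/3:
# the LINEAR comb bounds summed against the ℓ¹ mass of the circulations, `Σ_e |s(e)| ≤ 132·H·Σ_q |circ_s(q)|`

Linear twin of `Theorems/AllWindowsColdBoxDirichletPoincareSums.lean` (stub D of LINE-17): the same abstract configuration `s` (zero off the cold box and on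
the interior temporal forest), the same injectively parametrised temporal-plaquette families (a temporal plaquette with non-zero circulation lies in the
enlarged box: `base_bounds_of_sCirc_ne_zero`, `mem_image_shift_of_base_bounds`), with `|circ|` in place of `circ²` and the linear per-edge bounds of
`…DirichletCombBoundsLinear`; the ONLY factors of `H` are multiplicities (`2H` heights of spatial edges over one strip, `2H+1` steps of the bottom sweep),
so `Σ_{e ∈ boxEdges 4 (2H+1)} |s e| ≤ 132·H·F`, `F = Σ_{q ∈ shift(dirCorner) plaquettesIn {0..2H+2}⁴} |circ_s(q)|` (`sum_abs_boxEdges_le`).  Applied in part 3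
to the covariance configuration `e ↦ Cov_D(dirCirc_x, s_e)`, whose circulations are the kernel entries `K_H(x,·)`, this is the response bound K2 up to the
kernel's ℓ¹ mass.  The face majorant `Φ(t,z) = Σ_j (|circ((t,z−e_j);0,j+1)| + |circ((t,z);0,j+1)|)` and the mass `F` are spelled out in every statement.
Everything proved, no definition, standard axioms.  HONEST LABEL: helper toward one half of a registered bundle stub of a critic-passed line on the
R2ξ″ RECORD-rung crux 24006; no stub, crux, rung or summit is proved; the Clay Yang–Mills mass gap is NOT proved by any of this.
-/

set_option autoImplicit false

noncomputable section

open Finset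
open Literature.Probability.LatticeModels (Site mem_halfOpenBox halfOpenBox)
open Literature.MathematicalPhysics.QuantumFieldTheory
open Literature.MathematicalPhysics.QuantumFieldTheory.LatticeMaxwell
open Literature.MathematicalPhysics.QuantumFieldTheory.AxialGauge

namespace Summit.QuantumFields.YangMills.Theorems.AllWindowsColdBox.DirPoincare

open Summit.QuantumFields.YangMills.Theorems.WeakCouplingRates

section Config

variable {H : ℕ} (s : Literature.MathematicalPhysics.QuantumLattice.ZdEdge 4 → ℝ)
  (hout : ∀ e, e ∉ boxEdges 4 (2 * H + 1) → s e = 0)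
  (hforest : ∀ x : Site 4, (∀ k : Fin 4, 1 ≤ x k ∧ x k + 1 ≤ 2 * (H : ℤ)) → s (x, 0) = 0)

include hout in
/-- **Family bound, ℓ¹ form.**  Every injectively parametrised family of temporal plaquettes in a fixed plane `(0, j+1)` has total absolute
circulation at most the ℓ¹ mass of the circulations over the (translated) plaquettes of the enlarged box. -/
theorem sum_family_abs_le {κ : Type*} (A : Finset κ) (τ : κ → ℤ) (ω : κ → (Fin 3 → ℤ)) (j : Fin 3)
    (hinj : Set.InjOn (fun a => (τ a, ω a)) A) :
    ∑ a ∈ A, |sCirc s (Fin.cons (τ a) (ω a), 0, j.succ)| ≤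
      ∑ q ∈ (plaquettesIn (halfOpenBox 4 (2 * H + 3))).image (Plaq.shift dirCorner), |sCirc s q| := by
  classical
  set PB := (plaquettesIn (halfOpenBox 4 (2 * H + 3))).image (Plaq.shift dirCorner) with hPB
  set φ : κ → Plaq 4 := fun a => (Fin.cons (τ a) (ω a), 0, j.succ) with hφ
  have hφinj : Set.InjOn φ A := by
    intro a ha b hb hab
    simp only [hφ, Prod.mk.injEq] at hab
    have h2 := cons_inj2 hab.1
    exact hinj ha hb (Prod.ext h2.1 h2.2)
  have h1 : ∑ a ∈ A, |sCirc s (Fin.cons (τ a) (ω a), 0, j.succ)| = ∑ q ∈ A.image φ, |sCirc s q| := by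
    rw [Finset.sum_image hφinj]
  rw [h1]
  have h2 : ∑ q ∈ A.image φ, |sCirc s q| = ∑ q ∈ (A.image φ).filter (· ∈ PB), |sCirc s q| := by
    rw [Finset.sum_filter]
    refine Finset.sum_congr rfl fun q hq => ?_
    split_ifs with hmem
    · rfl
    · obtain ⟨a, -, rfl⟩ := Finset.mem_image.1 hq
      have : sCirc s (φ a) = 0 := by
        by_contra hne
        exact hmem (mem_image_shift_of_base_bounds (Fin.cons (τ a) (ω a)) j
          (base_bounds_of_sCirc_ne_zero s hout _ j hne))
      rw [this, abs_zero]
  rw [h2]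
  exact Finset.sum_le_sum_of_subset_of_nonneg (fun q hq => (Finset.mem_filter.1 hq).2) fun _ _ _ => abs_nonneg _

include hout in
/-- The face majorant summed over an injectively parametrised family of columns is `≤ 6F`. -/
theorem sum_faceAbs_le {κ : Type*} (A : Finset κ) (τ : κ → ℤ) (ω : κ → (Fin 3 → ℤ))
    (hinj : Set.InjOn (fun a => (τ a, ω a)) A) :
    ∑ a ∈ A, ∑ j : Fin 3, (|sCirc s (Fin.cons (τ a) (ω a - Pi.single j 1), 0, j.succ)| +
        |sCirc s (Fin.cons (τ a) (ω a), 0, j.succ)|) ≤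
      6 * ∑ q ∈ (plaquettesIn (halfOpenBox 4 (2 * H + 3))).image (Plaq.shift dirCorner), |sCirc s q| := by
  set F := ∑ q ∈ (plaquettesIn (halfOpenBox 4 (2 * H + 3))).image (Plaq.shift dirCorner), |sCirc s q| with hF
  rw [Finset.sum_comm]
  have hj : ∀ j : Fin 3, ∑ a ∈ A, (|sCirc s (Fin.cons (τ a) (ω a - Pi.single j 1), 0, j.succ)| +
      |sCirc s (Fin.cons (τ a) (ω a), 0, j.succ)|) ≤ 2 * F := by
    intro j
    rw [Finset.sum_add_distrib]
    have h1 := sum_family_abs_le s hout A τ (fun a => ω a - Pi.single j 1) j (by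
      intro a ha b hb hab
      simp only [Prod.mk.injEq, sub_left_inj] at hab
      exact hinj ha hb (Prod.ext hab.1 hab.2))
    have h2 := sum_family_abs_le s hout A τ ω j hinj
    rw [← hF] at h1 h2
    linarith
  calc ∑ j : Fin 3, ∑ a ∈ A, (|sCirc s (Fin.cons (τ a) (ω a - Pi.single j 1), 0, j.succ)| +
        |sCirc s (Fin.cons (τ a) (ω a), 0, j.succ)|)
      ≤ ∑ _j : Fin 3, 2 * F := Finset.sum_le_sum fun j _ => hj j
    _ = 6 * F := by simp; ring

include hout in
/-- A strip family, ℓ¹ form: `≤ F`. -/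
theorem sum_stripAbs_le (W : Finset (Fin 3 → ℤ)) (v : Fin 3 → ℤ) (j : Fin 3) :
    ∑ z ∈ W, ∑ t' ∈ Finset.Icc 1 (2 * H), |sCirc s (Fin.cons (t' : ℤ) (z + v), 0, j.succ)| ≤
      ∑ q ∈ (plaquettesIn (halfOpenBox 4 (2 * H + 3))).image (Plaq.shift dirCorner), |sCirc s q| := by
  rw [← Finset.sum_product']
  exact sum_family_abs_le s hout (W ×ˢ Finset.Icc 1 (2 * H)) (fun a => (a.2 : ℤ)) (fun a => a.1 + v) j (by
    intro a _ b _ hab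
    simp only [Prod.mk.injEq, Nat.cast_inj, add_left_inj] at hab
    exact Prod.ext hab.2 hab.1)

include hout in
/-- A column family of the face majorant, ℓ¹ form: `≤ 6F`. -/
theorem sum_faceAbsCol_le (W : Finset (Fin 3 → ℤ)) (v : Fin 3 → ℤ) :
    ∑ z ∈ W, ∑ t' ∈ Finset.Icc 1 (2 * H), ∑ j : Fin 3,
        (|sCirc s (Fin.cons (t' : ℤ) (z + v - Pi.single j 1), 0, j.succ)| + |sCirc s (Fin.cons (t' : ℤ) (z + v), 0, j.succ)|) ≤
      6 * ∑ q ∈ (plaquettesIn (halfOpenBox 4 (2 * H + 3))).image (Plaq.shift dirCorner), |sCirc s q| := by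
  rw [← Finset.sum_product']
  exact sum_faceAbs_le s hout (W ×ˢ Finset.Icc 1 (2 * H)) (fun a => (a.2 : ℤ)) (fun a => a.1 + v) (by
    intro a _ b _ hab
    simp only [Prod.mk.injEq, Nat.cast_inj, add_left_inj] at hab
    exact Prod.ext hab.2 hab.1)

include hout in
/-- A single-height family, ℓ¹ form: `≤ F`. -/
theorem sum_rowAbs_le (W : Finset (Fin 3 → ℤ)) (v : Fin 3 → ℤ) (t : ℤ) (j : Fin 3) :
    ∑ z ∈ W, |sCirc s (Fin.cons t (z + v), 0, j.succ)| ≤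
      ∑ q ∈ (plaquettesIn (halfOpenBox 4 (2 * H + 3))).image (Plaq.shift dirCorner), |sCirc s q| :=
  sum_family_abs_le s hout W (fun _ => t) (fun z => z + v) j (by
    intro a _ b _ hab
    simp only [Prod.mk.injEq, add_left_inj, true_and] at hab
    exact hab)

/-! ### The four edge classes, ℓ¹ form -/

include hout in
/-- (b) bottom-face spatial edges: `Σ_z Σ_j |s((0,z), j+1)| ≤ 3F`. -/
theorem classB_abs_le (W : Finset (Fin 3 → ℤ)) :
    ∑ z ∈ W, ∑ j : Fin 3, |s (Fin.cons 0 z, j.succ)| ≤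
      3 * ∑ q ∈ (plaquettesIn (halfOpenBox 4 (2 * H + 3))).image (Plaq.shift dirCorner), |sCirc s q| := by
  set F := ∑ q ∈ (plaquettesIn (halfOpenBox 4 (2 * H + 3))).image (Plaq.shift dirCorner), |sCirc s q| with hF
  rw [Finset.sum_comm]
  have hj : ∀ j : Fin 3, ∑ z ∈ W, |s (Fin.cons 0 z, j.succ)| ≤ F := fun j => by
    have h := sum_rowAbs_le s hout W 0 (-1) j
    simp only [add_zero] at h
    refine le_of_eq_of_le (Finset.sum_congr rfl fun z _ => ?_) h
    rw [s_bottom_spatial_eq s hout z j]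
  calc ∑ j : Fin 3, ∑ z ∈ W, |s (Fin.cons 0 z, j.succ)| ≤ ∑ _j : Fin 3, F := Finset.sum_le_sum fun j _ => hj j
    _ = 3 * F := by simp

include hout hforest in
/-- (c) temporal edges at heights `t ∈ [1, 2H]`: `Σ_t Σ_z |s((t,z), 0)| ≤ 6F`. -/
theorem classC_abs_le (W : Finset (Fin 3 → ℤ)) :
    ∑ t ∈ Finset.Icc 1 (2 * H), ∑ z ∈ W, |s (Fin.cons (t : ℤ) z, 0)| ≤
      6 * ∑ q ∈ (plaquettesIn (halfOpenBox 4 (2 * H + 3))).image (Plaq.shift dirCorner), |sCirc s q| := by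
  have h := sum_faceAbsCol_le s hout W 0
  simp only [add_zero] at h
  rw [Finset.sum_comm]
  refine le_trans (Finset.sum_le_sum fun z _ => Finset.sum_le_sum fun t ht => ?_) h
  exact abs_temporal_le s hout hforest (t : ℤ) (by have := (Finset.mem_Icc.1 ht).1; exact_mod_cast this) z

include hout hforest in
/-- The height-`≥ 1` spatial edge bound with the concrete face majorant, ℓ¹ form. -/
theorem abs_spatial_le' (t : ℕ) (ht : 1 ≤ t) (y : Fin 3 → ℤ) (i : Fin 3) :
    |s (Fin.cons (t : ℤ) y, i.succ)| ≤
      ∑ t' ∈ Finset.Icc 1 (2 * H), |sCirc s (Fin.cons (t' : ℤ) y, 0, i.succ)| +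
        ∑ t' ∈ Finset.Icc 1 (2 * H), ∑ j : Fin 3,
          (|sCirc s (Fin.cons (t' : ℤ) (y - Pi.single j 1), 0, j.succ)| + |sCirc s (Fin.cons (t' : ℤ) y, 0, j.succ)|) +
        ∑ t' ∈ Finset.Icc 1 (2 * H), ∑ j : Fin 3,
          (|sCirc s (Fin.cons (t' : ℤ) (y + Pi.single i 1 - Pi.single j 1), 0, j.succ)| +
            |sCirc s (Fin.cons (t' : ℤ) (y + Pi.single i 1), 0, j.succ)|) :=
  abs_spatial_le s hout (fun t z => ∑ j : Fin 3, (|sCirc s (Fin.cons t (z - Pi.single j 1), 0, j.succ)| +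
      |sCirc s (Fin.cons t z, 0, j.succ)|))
    (fun _ _ => Finset.sum_nonneg fun _ _ => by positivity) (fun t ht z => abs_temporal_le s hout hforest t ht z) t ht y i

include hout in
/-- The spatial-edge majorant of direction `i+1`, summed over any translated column set, ℓ¹ form: `≤ 13F`. -/
theorem sum_spatialAbs_majorant_le (W : Finset (Fin 3 → ℤ)) (v : Fin 3 → ℤ) (i : Fin 3) :
    ∑ z ∈ W, (∑ t' ∈ Finset.Icc 1 (2 * H), |sCirc s (Fin.cons (t' : ℤ) (z + v), 0, i.succ)| +
        ∑ t' ∈ Finset.Icc 1 (2 * H), ∑ j : Fin 3,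
          (|sCirc s (Fin.cons (t' : ℤ) (z + v - Pi.single j 1), 0, j.succ)| + |sCirc s (Fin.cons (t' : ℤ) (z + v), 0, j.succ)|) +
        ∑ t' ∈ Finset.Icc 1 (2 * H), ∑ j : Fin 3,
          (|sCirc s (Fin.cons (t' : ℤ) (z + v + Pi.single i 1 - Pi.single j 1), 0, j.succ)| +
            |sCirc s (Fin.cons (t' : ℤ) (z + v + Pi.single i 1), 0, j.succ)|)) ≤
      13 * ∑ q ∈ (plaquettesIn (halfOpenBox 4 (2 * H + 3))).image (Plaq.shift dirCorner), |sCirc s q| := by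
  rw [Finset.sum_add_distrib, Finset.sum_add_distrib]
  have h1 := sum_stripAbs_le s hout W v i
  have h2 := sum_faceAbsCol_le s hout W v
  have h3 := sum_faceAbsCol_le s hout W (v + Pi.single i 1)
  simp only [← add_assoc] at h3
  linarith

include hout hforest in
/-- (d) spatial edges at heights `t ∈ [1, 2H]`, ℓ¹ form: `Σ_t Σ_z Σ_j |s((t,z), j+1)| ≤ 2H · 39F`. -/
theorem classD_abs_le (W : Finset (Fin 3 → ℤ)) :
    ∑ t ∈ Finset.Icc 1 (2 * H), ∑ z ∈ W, ∑ j : Fin 3, |s (Fin.cons (t : ℤ) z, j.succ)| ≤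
      2 * H * (39 * ∑ q ∈ (plaquettesIn (halfOpenBox 4 (2 * H + 3))).image (Plaq.shift dirCorner), |sCirc s q|) := by
  set F := ∑ q ∈ (plaquettesIn (halfOpenBox 4 (2 * H + 3))).image (Plaq.shift dirCorner), |sCirc s q| with hF
  set M : ℝ := ∑ z ∈ W, ∑ j : Fin 3,
    (∑ t' ∈ Finset.Icc 1 (2 * H), |sCirc s (Fin.cons (t' : ℤ) z, 0, j.succ)| +
      ∑ t' ∈ Finset.Icc 1 (2 * H), ∑ j' : Fin 3,
        (|sCirc s (Fin.cons (t' : ℤ) (z - Pi.single j' 1), 0, j'.succ)| + |sCirc s (Fin.cons (t' : ℤ) z, 0, j'.succ)|) +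
      ∑ t' ∈ Finset.Icc 1 (2 * H), ∑ j' : Fin 3,
        (|sCirc s (Fin.cons (t' : ℤ) (z + Pi.single j 1 - Pi.single j' 1), 0, j'.succ)| +
          |sCirc s (Fin.cons (t' : ℤ) (z + Pi.single j 1), 0, j'.succ)|)) with hM
  have hle : ∀ t ∈ Finset.Icc 1 (2 * H), ∑ z ∈ W, ∑ j : Fin 3, |s (Fin.cons (t : ℤ) z, j.succ)| ≤ M := by
    intro t ht
    exact Finset.sum_le_sum fun z _ => Finset.sum_le_sum fun j _ => abs_spatial_le' s hout hforest t (Finset.mem_Icc.1 ht).1 z j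
  have hM_le : M ≤ 39 * F := by
    rw [hM, Finset.sum_comm]
    have hj : ∀ j : Fin 3, ∑ z ∈ W,
        (∑ t' ∈ Finset.Icc 1 (2 * H), |sCirc s (Fin.cons (t' : ℤ) z, 0, j.succ)| +
          ∑ t' ∈ Finset.Icc 1 (2 * H), ∑ j' : Fin 3,
            (|sCirc s (Fin.cons (t' : ℤ) (z - Pi.single j' 1), 0, j'.succ)| + |sCirc s (Fin.cons (t' : ℤ) z, 0, j'.succ)|) +
          ∑ t' ∈ Finset.Icc 1 (2 * H), ∑ j' : Fin 3,
            (|sCirc s (Fin.cons (t' : ℤ) (z + Pi.single j 1 - Pi.single j' 1), 0, j'.succ)| +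
              |sCirc s (Fin.cons (t' : ℤ) (z + Pi.single j 1), 0, j'.succ)|)) ≤ 13 * F := by
      intro j
      have h := sum_spatialAbs_majorant_le s hout W 0 j
      simpa only [add_zero] using h
    calc _ ≤ ∑ _j : Fin 3, 13 * F := Finset.sum_le_sum fun j _ => hj j
      _ = 39 * F := by simp; ring
  calc ∑ t ∈ Finset.Icc 1 (2 * H), ∑ z ∈ W, ∑ j : Fin 3, |s (Fin.cons (t : ℤ) z, j.succ)|
      ≤ ∑ _t ∈ Finset.Icc 1 (2 * H), M := Finset.sum_le_sum hle
    _ = 2 * H * M := by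
        rw [Finset.sum_const, Nat.card_Icc, nsmul_eq_mul]
        have : (2 * H + 1 - 1 : ℕ) = 2 * H := by omega
        rw [this]; push_cast; ring
    _ ≤ 2 * H * (39 * F) := by
        have : (0 : ℝ) ≤ 2 * H := by positivity
        exact mul_le_mul_of_nonneg_left hM_le this

include hout in
/-- One step of the bottom sweep, summed over a translated column set, ℓ¹ form: `≤ 15F`. -/
theorem sweep_step_abs_sum_le (W : Finset (Fin 3 → ℤ)) (v : Fin 3 → ℤ) :
    ∑ z ∈ W, (|sCirc s (Fin.cons 0 (z + v), 0, (0 : Fin 3).succ)| +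
        |sCirc s (Fin.cons (-1) (z + v), 0, (0 : Fin 3).succ)| +
        (∑ t' ∈ Finset.Icc 1 (2 * H), |sCirc s (Fin.cons (t' : ℤ) (z + v), 0, (0 : Fin 3).succ)| +
          ∑ t' ∈ Finset.Icc 1 (2 * H), ∑ j : Fin 3,
            (|sCirc s (Fin.cons (t' : ℤ) (z + v - Pi.single j 1), 0, j.succ)| + |sCirc s (Fin.cons (t' : ℤ) (z + v), 0, j.succ)|) +
          ∑ t' ∈ Finset.Icc 1 (2 * H), ∑ j : Fin 3,
            (|sCirc s (Fin.cons (t' : ℤ) (z + v + Pi.single 0 1 - Pi.single j 1), 0, j.succ)| +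
              |sCirc s (Fin.cons (t' : ℤ) (z + v + Pi.single 0 1), 0, j.succ)|))) ≤
      15 * ∑ q ∈ (plaquettesIn (halfOpenBox 4 (2 * H + 3))).image (Plaq.shift dirCorner), |sCirc s q| := by
  rw [Finset.sum_add_distrib, Finset.sum_add_distrib]
  have h1 := sum_rowAbs_le s hout W v 0 0
  have h2 := sum_rowAbs_le s hout W v (-1) 0
  have h3 := sum_spatialAbs_majorant_le s hout W v 0
  linarith

include hout hforest in
/-- The per-edge bottom temporal bound with the concrete majorants, ℓ¹ form. -/
theorem abs_bottom_temporal_le' (z : Fin 3 → ℤ) (hz : 0 ≤ z 0) :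
    |s (Fin.cons 0 z, 0)| ≤ ∑ k ∈ Finset.range (2 * H + 1),
      (|sCirc s (Fin.cons 0 (z + Pi.single 0 (k : ℤ)), 0, (0 : Fin 3).succ)| +
        |sCirc s (Fin.cons (-1) (z + Pi.single 0 (k : ℤ)), 0, (0 : Fin 3).succ)| +
        (∑ t' ∈ Finset.Icc 1 (2 * H), |sCirc s (Fin.cons (t' : ℤ) (z + Pi.single 0 (k : ℤ)), 0, (0 : Fin 3).succ)| +
          ∑ t' ∈ Finset.Icc 1 (2 * H), ∑ j : Fin 3,
            (|sCirc s (Fin.cons (t' : ℤ) (z + Pi.single 0 (k : ℤ) - Pi.single j 1), 0, j.succ)| +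
              |sCirc s (Fin.cons (t' : ℤ) (z + Pi.single 0 (k : ℤ)), 0, j.succ)|) +
          ∑ t' ∈ Finset.Icc 1 (2 * H), ∑ j : Fin 3,
            (|sCirc s (Fin.cons (t' : ℤ) (z + Pi.single 0 (k : ℤ) + Pi.single 0 1 - Pi.single j 1), 0, j.succ)| +
              |sCirc s (Fin.cons (t' : ℤ) (z + Pi.single 0 (k : ℤ) + Pi.single 0 1), 0, j.succ)|))) := by
  have hΨ : ∀ w, |s (Fin.cons 1 w, (0 : Fin 3).succ)| ≤ (fun w =>
      (∑ t' ∈ Finset.Icc 1 (2 * H), |sCirc s (Fin.cons (t' : ℤ) w, 0, (0 : Fin 3).succ)| +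
        ∑ t' ∈ Finset.Icc 1 (2 * H), ∑ j : Fin 3,
          (|sCirc s (Fin.cons (t' : ℤ) (w - Pi.single j 1), 0, j.succ)| + |sCirc s (Fin.cons (t' : ℤ) w, 0, j.succ)|) +
        ∑ t' ∈ Finset.Icc 1 (2 * H), ∑ j : Fin 3,
          (|sCirc s (Fin.cons (t' : ℤ) (w + Pi.single 0 1 - Pi.single j 1), 0, j.succ)| +
            |sCirc s (Fin.cons (t' : ℤ) (w + Pi.single 0 1), 0, j.succ)|))) w := by
    intro w
    have h := abs_spatial_le' s hout hforest 1 le_rfl w 0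
    rw [Nat.cast_one] at h
    exact h
  have h := abs_bottom_temporal_le s hout _ hΨ z hz
  simp only at h
  exact h

include hout hforest in
/-- (a) bottom temporal («Polyakov») edges, ℓ¹ form: `Σ_{z ∈ {0..2H}³} |s((0,z),0)| ≤ (2H+1)·15F`. -/
theorem classA_abs_le :
    ∑ z ∈ halfOpenBox 3 (2 * H + 1), |s (Fin.cons 0 z, 0)| ≤
      (2 * H + 1) * (15 * ∑ q ∈ (plaquettesIn (halfOpenBox 4 (2 * H + 3))).image (Plaq.shift dirCorner), |sCirc s q|) := by
  set W := halfOpenBox 3 (2 * H + 1) with hW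
  have hz : ∀ z ∈ W, |s (Fin.cons 0 z, 0)| ≤ _ := fun z hzW =>
    abs_bottom_temporal_le' s hout hforest z ((mem_halfOpenBox.1 hzW) 0).1
  refine (Finset.sum_le_sum hz).trans ?_
  rw [Finset.sum_comm]
  refine (Finset.sum_le_sum fun (k : ℕ) _ => sweep_step_abs_sum_le s hout W (Pi.single 0 (k : ℤ))).trans ?_
  rw [Finset.sum_const, Finset.card_range, nsmul_eq_mul]; push_cast
  exact le_of_eq (by ring)

include hout hforest in
/-- **The ℓ¹ comb inequality, abstract form**: for every real edge configuration vanishing off the cold box `{0,…,2H}⁴` and on the interior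
temporal forest, `Σ_e |s(e)| ≤ 132·H·Σ_q |circ_s(q)|`, the sum on the right over the (translated) plaquettes of the enlarged box (`H ≥ 1`). -/
theorem sum_abs_boxEdges_le (hH : 1 ≤ H) :
    ∑ e ∈ boxEdges 4 (2 * H + 1), |s e| ≤
      132 * (H : ℝ) * ∑ q ∈ (plaquettesIn (halfOpenBox 4 (2 * H + 3))).image (Plaq.shift dirCorner), |sCirc s q| := by
  set F := ∑ q ∈ (plaquettesIn (halfOpenBox 4 (2 * H + 3))).image (Plaq.shift dirCorner), |sCirc s q| with hF
  have hF0 : 0 ≤ F := Finset.sum_nonneg fun _ _ => abs_nonneg _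
  set W := halfOpenBox 3 (2 * H + 1) with hW
  have h1 := sum_boxEdges_le_sum_cons (H := H) (fun e => |s e|) (fun _ => abs_nonneg _)
  refine h1.trans ?_
  have hsplit : ∑ t ∈ Finset.range (2 * H + 1), ∑ z ∈ W, ∑ i : Fin 4, |s (Fin.cons (t : ℤ) z, i)| =
      (∑ z ∈ W, |s (Fin.cons 0 z, 0)| + ∑ z ∈ W, ∑ j : Fin 3, |s (Fin.cons 0 z, j.succ)|) +
      (∑ t ∈ Finset.Icc 1 (2 * H), ∑ z ∈ W, |s (Fin.cons (t : ℤ) z, 0)| +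
        ∑ t ∈ Finset.Icc 1 (2 * H), ∑ z ∈ W, ∑ j : Fin 3, |s (Fin.cons (t : ℤ) z, j.succ)|) := by
    have hI : Finset.Ico 1 (2 * H + 1) = Finset.Icc 1 (2 * H) := Finset.Ico_succ_right_eq_Icc 1 (2 * H)
    rw [Finset.range_eq_Ico, Finset.sum_eq_sum_Ico_succ_bot (by omega : 0 < 2 * H + 1), zero_add, hI]
    simp only [Fin.sum_univ_succ, Finset.sum_add_distrib, Nat.cast_zero]
  rw [hsplit]
  have hA := classA_abs_le s hout hforest (H := H)
  have hB := classB_abs_le s hout W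
  have hC := classC_abs_le s hout hforest W
  have hD := classD_abs_le s hout hforest W
  have hH' : (1 : ℝ) ≤ H := by exact_mod_cast hH
  nlinarith [mul_nonneg hF0 (by positivity : (0:ℝ) ≤ H), mul_nonneg hF0 (by linarith : (0:ℝ) ≤ H - 1)]

end Config

end Summit.QuantumFields.YangMills.Theorems.AllWindowsColdBox.DirPoincare

end
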